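import Summits.QuantumAdvantage.QuantumAdvantage.Theorems.NearExactIsExact.Negative.QuarterSlicingFourteen
import Summits.QuantumAdvantage.QuantumAdvantage.Theorems.CubicForrelationNearExactIsExactFlatRadical
import Summits.QuantumAdvantage.QuantumAdvantage.Theorems.CubicForrelationNearExactIsExactFlatSumsGeneral

/-!
# A case-A type-O cubic on 14 bits has a digit quadratic of rank ≤ 2 (frame-free)
# (THEOREM CA-W, Step 1; NearExactIsExact, disprover gen 23)

Negative/structural lemma for the crux `CubicForrelation.NearExactIsExact` (item r2), finite slice `n = 14`;
ONE-SIDED (no partner `f`) and FRAME-FREE (no choice of dual coordinates).  HONEST FRAMING: a theorem about a single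
cubic Boolean function on 14 bits — NOT summit progress; no violation of `NearExactIsExact`, no per-`n` value.

Statement (`caseA_radical_large`), in the vocabulary of the census theorem `fo_second_structure_sharp`: let `g` be
cubic on `14` bits with `W_g = 32u`, every `u(x)` odd (type O) and CASE A (`[⌊u/2⌋ odd] ≠ [⌊u/4⌋ odd]` everywhere).
Then the radical `R = {a : ∀ b, d₁(0) ⊕ d₁(a) ⊕ d₁(b) ⊕ d₁(a ⊕ b) = 0}` of the digit `d₁ = [⌊u/2⌋ odd]` has
`#R ≥ 2¹²` — i.e. the alternating form of `d₁` has rank `≤ 2`.  Consequently, in the type-O alternative of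
`fo_second_structure_sharp` ("`#R < 2¹²` or case A" on each side) the two disjuncts are mutually exclusive.

Proof: in case A `u ≡ 4 + (−1)^{d₁} (mod 8)` pointwise (`qs_residue`), so every parametrised `k`-flat sum of
`(−1)^{d₁}` equals the flat sum of `u` minus `4·2^k` modulo `8`; the flat sums of `u = W_g/32` over `3`-flats are
`≡ 0 (mod 4)` and over `4`-flats `≡ 0 (mod 8)` (`fs_flat_sum_dvd`: Poisson summation plus Ax/McEliece on the annihilator);
hence hypotheses (H3)/(H4) of the landed radical engine `fr_radical_large` hold for `d₁` on the whole space, which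
gives `2¹⁴ ≤ 4·#R` (otherwise two orthogonal hyperbolic pairs of the form give a `4`-flat on which `d₁` is bent, sign
sum `±4`).  The coordinate normal form of the same fact is `RankFourNotCaseAFourteen.rank_four_caseA_false`.

Sources: Ax / McEliece [cite Carlet2020 §4.1] and the symplectic structure of quadratic forms
[cite MacWilliamsSloane1977 Ch. 15 §2] via the tree lemmas `fs_flat_sum_dvd`, `fr_radical_large`; the rest
[this work].  Standard axioms only.
-/

set_option linter.dupNamespace false -- D-0017: single-problem summit ⇒ `QuantumAdvantage.QuantumAdvantage` by design

noncomputable section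

namespace Summit.QuantumAdvantage.QuantumAdvantage.Theorems.NearExactIsExact.Negative.CaseARankTwoFourteen

open Finset
open Literature.Computability.QuantumComplexity
open Literature.Computability.QuantumComplexity.BuzetChailloux (bxor zeroVec zeroVec_bxor)
open Literature.Computability.QuantumComplexity.DerivativeWalsh (W)
open Summit.QuantumAdvantage.QuantumAdvantage.Theorems.CubicForrelation.NearExactIsExact
open Summit.QuantumAdvantage.QuantumAdvantage.Theorems.NearExactIsExact.Negative.QuarterSlicingFourteen (qs_residue)

/-- In case A the integer sign of the digit is `u − 4 (mod 8)`: `(−1)^{d₁(x)} = u(x) − 8⌊u(x)/8⌋ − 4`. [this work] -/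
theorem cr_sZ_digit (u : (Fin (7 + 7) → Bool) → ℤ) (hodd : ∀ x, Odd (u x))
    (hA : ∀ x, ¬ (Odd (u x / 2) ↔ Odd (u x / 2 / 2))) (x : Fin (7 + 7) → Bool) :
    sZ (decide (Odd (u x / 2))) = u x - 8 * (u x / 8) - 4 := by
  have hr := qs_residue (u x) (hodd x) (hA x)
  by_cases ho : Odd (u x / 2)
  · rw [decide_eq_true ho, show sZ true = -1 from rfl]
    have h3 := hr.1 ho
    omega
  · rw [decide_eq_false ho, show sZ false = 1 from rfl]
    have h5 := hr.2 ho
    omega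

/-- The number of parameters of a `k`-flat: `#(𝔽₂^k) = 2^k`. [folklore] -/
theorem cr_card_params (k : ℕ) : #(univ : Finset (Fin k → Bool)) = 2 ^ k := by
  rw [card_univ, Fintype.card_fun, Fintype.card_bool, Fintype.card_fin]

/-- **Flat sums of the digit sign in case A.** For a parametrised `k`-flat (`k = 3`: mod `4`; `k = 4`: mod `8`) the sum of
`(−1)^{d₁}` is divisible as stated, because the flat sum of `u` is (`fs_flat_sum_dvd`) and `4·2^k ≡ 0`. [this work] -/
theorem cr_flat_sZ_dvd {k e : ℕ} (g : (Fin (7 + 7) → Bool) → Bool) (hg : IsDegLeFun 3 g)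
    (u : (Fin (7 + 7) → Bool) → ℤ) (hu : ∀ x, W (fun y => signOf (g y)) x = (2 : ℝ) ^ 5 * (u x : ℝ))
    (hodd : ∀ x, Odd (u x)) (hA : ∀ x, ¬ (Odd (u x / 2) ↔ Odd (u x / 2 / 2)))
    (he : 5 + e ≤ k + (7 + 7 - k + 2) / 3) (he3 : e ≤ 3) (hk : 2 ≤ k) (x : Fin (7 + 7) → Bool)
    (a : Fin k → Fin (7 + 7) → Bool) :
    (2 : ℤ) ^ e ∣ ∑ ε : Fin k → Bool, sZ (decide (Odd (u (fun j => x j ^^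
      decide (Odd #(univ.filter fun i => ε i && a i j))) / 2))) := by
  classical
  have hdvd := fs_flat_sum_dvd (e := e) g u hg hu x a he
  rw [sum_congr rfl fun ε _ => cr_sZ_digit u hodd hA _, sum_sub_distrib, sum_sub_distrib, ← mul_sum, sum_const,
    cr_card_params, nsmul_eq_mul]
  -- 2^e ∣ S − 8·Q − 2^k·4 with e ≤ 3 ≤ k + 2
  have h8 : (2 : ℤ) ^ e ∣ 8 := by
    rw [show (8 : ℤ) = 2 ^ 3 from by norm_num]; exact pow_dvd_pow 2 he3
  have h2k : (2 : ℤ) ^ e ∣ (2 ^ k : ℕ) * 4 := by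
    push_cast
    rw [show (2 : ℤ) ^ k * 4 = 2 ^ (k + 2) from by ring]
    exact pow_dvd_pow 2 (by omega)
  exact dvd_sub (dvd_sub hdvd (dvd_mul_of_dvd_left h8 _)) h2k

set_option maxHeartbeats 400000 in
/-- **THEOREM CA-W, Step 1 (frame-free): case A forces rank `d₁ ≤ 2`.** For a cubic `g` on `14` bits with
`W_g = 32u`, all `u(x)` odd and `[⌊u/2⌋ odd] ≠ [⌊u/4⌋ odd]` everywhere, the radical of the first digit
`d₁ = [⌊u/2⌋ odd]` has at least `2¹²` elements.  ONE-SIDED; NOT summit progress. [this work] -/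
theorem caseA_radical_large (g : (Fin (7 + 7) → Bool) → Bool) (hg : IsDegLeFun 3 g)
    (u : (Fin (7 + 7) → Bool) → ℤ) (hu : ∀ x, W (fun y => signOf (g y)) x = (2 : ℝ) ^ 5 * (u x : ℝ))
    (hodd : ∀ x, Odd (u x)) (hA : ∀ x, ¬ (Odd (u x / 2) ↔ Odd (u x / 2 / 2))) :
    2 ^ 12 ≤ #(univ.filter fun a : Fin (7 + 7) → Bool => ∀ b,
      (decide (Odd (u zeroVec / 2)) ^^ decide (Odd (u a / 2)) ^^ decide (Odd (u b / 2)) ^^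
        decide (Odd (u (bxor a b) / 2))) = false) := by
  classical
  have H3 : ∀ x : Fin (7 + 7) → Bool, True → ∀ a b c : Fin (7 + 7) → Bool, a ∈ univ → b ∈ univ → c ∈ univ →
      (4 : ℤ) ∣ ∑ ε : Fin 3 → Bool, sZ (decide (Odd (u (fun j => x j ^^ decide (Odd #(univ.filter fun i =>
        ε i && (![a, b, c] : Fin 3 → Fin (7 + 7) → Bool) i j))) / 2))) := by
    intro x _ a b c _ _ _
    have h := cr_flat_sZ_dvd (k := 3) (e := 2) g hg u hu hodd hA (by norm_num) (by norm_num) (by norm_num) x ![a, b, c]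
    rw [show (2 : ℤ) ^ 2 = 4 from by norm_num] at h
    exact h
  have H4 : ∀ x : Fin (7 + 7) → Bool, True → ∀ a₀ a₁ a₂ a₃ : Fin (7 + 7) → Bool, a₀ ∈ univ → a₁ ∈ univ → a₂ ∈ univ →
      a₃ ∈ univ → (8 : ℤ) ∣ ∑ ε : Fin 4 → Bool, sZ (decide (Odd (u (fun j => x j ^^
        decide (Odd #(univ.filter fun i => ε i && (![a₀, a₁, a₂, a₃] : Fin 4 → Fin (7 + 7) → Bool) i j))) / 2))) := by
    intro x _ a₀ a₁ a₂ a₃ _ _ _ _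
    have h := cr_flat_sZ_dvd (k := 4) (e := 3) g hg u hu hodd hA (by norm_num) (by norm_num) (by norm_num) x
      ![a₀, a₁, a₂, a₃]
    rw [show (2 : ℤ) ^ 3 = 8 from by norm_num] at h
    exact h
  have H := fr_radical_large (univ : Finset (Fin (7 + 7) → Bool)) (fun _ => True) zeroVec
    (fun y => decide (Odd (u y / 2))) (fun a _ b _ => mem_univ _) trivial (fun _ _ _ _ => trivial)
    (fun _ _ => mem_univ _) H3 H4
  simp only [zeroVec_bxor, mem_univ, true_implies] at H
  rw [cr_card_params, show (2 : ℕ) ^ (7 + 7) = 4 * 2 ^ 12 from by norm_num] at H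
  exact Nat.le_of_mul_le_mul_left H (by norm_num)

end Summit.QuantumAdvantage.QuantumAdvantage.Theorems.NearExactIsExact.Negative.CaseARankTwoFourteen

end
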